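import Mathlib
import HarnessLib
import Summits.AtomisticToContinuum.FouriersLaw.Theses.JunctionLocality
import Summits.AtomisticToContinuum.FouriersLaw.Theorems.JunctionLocalitySuperadditiveResistanceDeviceLiouville

/-!
# Bypass-bound helpers I: Gaussian integration by parts in a bath momentum
(helpers `--supports` stmt-AtomisticToContinuum-11748 for stub `stub_bypassBound` of line
`floating-probe-bypass-laplacian`, crux `JunctionLocality.SuperadditiveResistance`)

The bypass conductance of the line's device is `x = −K_03 = (γ²/T²) ⟨g_0, p_{L−1}² − T⟩_{μ_T}`
(`L = N + M`, `g_0` the left bath's forward field). This file proves the exact identity behind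
every estimate of such pairings: for the Gibbs density `ρ_T = e^{−H/T}` of ANY oscillator chain
(only `∂_{p_j} H = p_j` is used) and any `F` with a line derivative `F'` along `(0, e_j)`,

  `∫ F (p_j² − T) ρ_T = T ∫ F' p_j ρ_T`                      (`integral_mul_sq_sub_mul_gibbsDensity`)

under the three integrability conditions that make both sides honest (no compact support, no
cutoff: Mathlib's integration by parts for integrable products). Corollaries: equipartition
`∫ (p_j² − T) ρ_T = 0`; INVISIBILITY `∫ F (p_j² − T) ρ_T = 0` whenever `F` does not depend on `p_j`
(e.g. an observable of the left block against the right bath's source); and the real-analysis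
Cauchy–Schwarz inequality `|∫ u v| ≤ ‖u‖₂ ‖v‖₂` for `L²` functions used downstream. Part II
(`…StubBypassBoundAux2`) specialises to the pinned chain's Gibbs MEASURE and to forward fields.
-/

noncomputable section

open MeasureTheory Filter Topology
open scoped ContDiff
open Literature.MathematicalPhysics.KineticTheory.HeatConduction

namespace Summit.AtomisticToContinuum.FouriersLaw.Cruxes.SuperadditiveResistance.FloatingProbeBypassLaplacian

/-! ## Cauchy–Schwarz for real `L²` functions (discriminant form) -/

section CauchySchwarz

variable {α : Type*} [MeasurableSpace α] {μ : Measure α}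

/-- `|∫ u v dμ| ≤ √(∫ u² dμ) · √(∫ v² dμ)` for real `u, v ∈ L²(μ)` (the quadratic
`t ↦ ∫ (t u + v)² ≥ 0` has non-positive discriminant). [folklore] -/
theorem abs_integral_mul_le {u v : α → ℝ} (hu : MemLp u 2 μ) (hv : MemLp v 2 μ) :
    |∫ x, u x * v x ∂μ| ≤ Real.sqrt (∫ x, u x ^ 2 ∂μ) * Real.sqrt (∫ x, v x ^ 2 ∂μ) := by
  have iu : Integrable (fun x => u x ^ 2) μ := hu.integrable_sq
  have iv : Integrable (fun x => v x ^ 2) μ := hv.integrable_sq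
  have iuv : Integrable (fun x => u x * v x) μ := hu.integrable_mul hv
  have hq : ∀ t : ℝ, 0 ≤ (∫ x, u x ^ 2 ∂μ) * (t * t) + (2 * ∫ x, u x * v x ∂μ) * t +
      ∫ x, v x ^ 2 ∂μ := by
    intro t
    have hnn : 0 ≤ ∫ x, (t * u x + v x) ^ 2 ∂μ := integral_nonneg fun x => sq_nonneg _
    have i1 : Integrable (fun x => (t * t) * u x ^ 2) μ := iu.const_mul _
    have i2 : Integrable (fun x => (2 * t) * (u x * v x)) μ := iuv.const_mul _
    have i12 : Integrable (fun x => (t * t) * u x ^ 2 + (2 * t) * (u x * v x)) μ := i1.add i2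
    have e1 : ∫ x, (t * u x + v x) ^ 2 ∂μ =
        ∫ x, ((t * t) * u x ^ 2 + (2 * t) * (u x * v x)) + v x ^ 2 ∂μ :=
      integral_congr_ae (ae_of_all _ fun x => by ring)
    rw [e1, integral_add i12 iv, integral_add i1 i2, integral_const_mul, integral_const_mul] at hnn
    linarith
  have hd := discrim_le_zero hq
  rw [discrim] at hd
  have hsq : (∫ x, u x * v x ∂μ) ^ 2 ≤ (∫ x, u x ^ 2 ∂μ) * ∫ x, v x ^ 2 ∂μ := by nlinarith [hd]
  rw [← Real.sqrt_mul (integral_nonneg fun x => sq_nonneg _), ← Real.sqrt_sq_eq_abs]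
  exact Real.sqrt_le_sqrt hsq

end CauchySchwarz

/-! ## Gaussian integration by parts in one momentum against `e^{-H/T}` -/

section GaussianIBP

variable {L : ℕ}

/-- The momentum coordinate `p_j` has line derivative `1` along `(0, e_j)`. [folklore] -/
theorem hasLineDerivAt_snd_apply (j : Fin L) (x : PhaseSpace L) :
    HasLineDerivAt ℝ (fun y : PhaseSpace L => y.2 j) 1 x ((0, Pi.single j 1) : PhaseSpace L) := by
  unfold HasLineDerivAt
  have h : (fun t : ℝ => (x + t • ((0, Pi.single j 1) : PhaseSpace L)).2 j) = fun t => x.2 j + t := by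
    funext t
    simp
  rw [h]
  exact (hasDerivAt_id' (0 : ℝ)).const_add (x.2 j)

/-- A function which is constant along the `p_j`-lines has line derivative `0` along `(0, e_j)`
(no regularity needed). [folklore] -/
theorem hasLineDerivAt_zero_of_forall_add_smul {F : PhaseSpace L → ℝ} (j : Fin L)
    (hF : ∀ (x : PhaseSpace L) (t : ℝ), F (x + t • ((0, Pi.single j 1) : PhaseSpace L)) = F x)
    (x : PhaseSpace L) :
    HasLineDerivAt ℝ F 0 x ((0, Pi.single j 1) : PhaseSpace L) := by
  unfold HasLineDerivAt
  have h : (fun t : ℝ => F (x + t • ((0, Pi.single j 1) : PhaseSpace L))) = fun _ => F x :=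
    funext fun t => hF x t
  rw [h]
  exact hasDerivAt_const 0 (F x)

variable (P : OscillatorChain)

/-- `∂_{p_j}(p_j e^{-H/T}) = (1 − p_j²/T) e^{-H/T}` along `(0, e_j)` (uses only `∂_{p_j} H = p_j`).
[folklore] -/
theorem hasLineDerivAt_snd_mul_gibbsDensity (T : ℝ) (j : Fin L) (x : PhaseSpace L) :
    HasLineDerivAt ℝ (fun y : PhaseSpace L => y.2 j * P.gibbsDensity L T y)
      ((1 - x.2 j ^ 2 / T) * P.gibbsDensity L T x) x ((0, Pi.single j 1) : PhaseSpace L) := by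
  have hρ := P.hasLineDerivAt_gibbsDensity (T := T) (P.hasLineDerivAt_hamiltonian_unitP L x j)
  have hp := hasLineDerivAt_snd_apply j x
  unfold HasLineDerivAt at hρ hp ⊢
  have h := hp.mul hρ
  simp only [zero_smul, add_zero] at h
  refine h.congr_deriv ?_
  ring

/-- **Gaussian integration by parts in the momentum `p_j`.** For any oscillator chain, `T ≠ 0`,
and `F` with line derivative `F'` along `(0, e_j)`: `∫ F (p_j² − T) e^{-H/T} = T ∫ F' p_j e^{-H/T}`,
provided `F e^{-H/T}`, `F p_j² e^{-H/T}`, `F p_j e^{-H/T}`, `F' p_j e^{-H/T}` are Lebesgue integrable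
(`p_j e^{-H/T} = −T ∂_{p_j} e^{-H/T}`; Mathlib's integration by parts for integrable products, no
support condition). [folklore] -/
theorem integral_mul_sq_sub_mul_gibbsDensity {T : ℝ} (hT : T ≠ 0) (j : Fin L)
    {F F' : PhaseSpace L → ℝ}
    (hF : ∀ x, HasLineDerivAt ℝ F (F' x) x ((0, Pi.single j 1) : PhaseSpace L))
    (h0 : Integrable fun x => F x * P.gibbsDensity L T x)
    (h2 : Integrable fun x => F x * x.2 j ^ 2 * P.gibbsDensity L T x)
    (h1 : Integrable fun x => F x * x.2 j * P.gibbsDensity L T x)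
    (h3 : Integrable fun x => F' x * x.2 j * P.gibbsDensity L T x) :
    ∫ x, F x * (x.2 j ^ 2 - T) * P.gibbsDensity L T x =
      T * ∫ x, F' x * x.2 j * P.gibbsDensity L T x := by
  haveI := isAddHaarMeasure_volume_phaseSpace L
  have e := integral_bilinear_hasLineDerivAt_right_eq_neg_left_of_integrable
    (μ := (volume : Measure (PhaseSpace L))) (B := ContinuousLinearMap.mul ℝ ℝ)
    (f := F) (f' := F') (g := fun y : PhaseSpace L => y.2 j * P.gibbsDensity L T y)
    (g' := fun x => (1 - x.2 j ^ 2 / T) * P.gibbsDensity L T x)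
    (v := ((0, Pi.single j 1) : PhaseSpace L)) ?_ ?_ ?_ (fun x _ => hF x)
    (fun x _ => hasLineDerivAt_snd_mul_gibbsDensity P T j x)
  · simp only [ContinuousLinearMap.mul_apply'] at e
    have hTT : T⁻¹ * T = 1 := inv_mul_cancel₀ hT
    have e1 : ∫ x, F x * ((1 - x.2 j ^ 2 / T) * P.gibbsDensity L T x) =
        -T⁻¹ * ∫ x, F x * (x.2 j ^ 2 - T) * P.gibbsDensity L T x := by
      rw [← integral_const_mul]
      refine integral_congr_ae (ae_of_all _ fun x => ?_)
      linear_combination (-(F x * P.gibbsDensity L T x)) * hTT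
    have e2 : ∫ x, F' x * (x.2 j * P.gibbsDensity L T x) =
        ∫ x, F' x * x.2 j * P.gibbsDensity L T x :=
      integral_congr_ae (ae_of_all _ fun x => by ring)
    rw [e1, e2] at e
    have e3 : ∫ x, F' x * x.2 j * P.gibbsDensity L T x =
        T⁻¹ * ∫ x, F x * (x.2 j ^ 2 - T) * P.gibbsDensity L T x := by linarith
    rw [e3, ← mul_assoc, mul_inv_cancel₀ hT, one_mul]
  · simp only [ContinuousLinearMap.mul_apply']
    simpa [mul_assoc] using h3
  · simp only [ContinuousLinearMap.mul_apply']
    have i1 : Integrable (fun x => F x * P.gibbsDensity L T x -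
        T⁻¹ * (F x * x.2 j ^ 2 * P.gibbsDensity L T x)) := h0.sub (h2.const_mul T⁻¹)
    refine i1.congr (ae_of_all _ fun x => ?_)
    simp only
    ring
  · simp only [ContinuousLinearMap.mul_apply']
    simpa [mul_assoc] using h1

/-- **Equipartition** `∫ (p_j² − T) e^{-H/T} = 0` (`T ≠ 0`; the three moments integrable). [folklore] -/
theorem integral_sq_sub_mul_gibbsDensity {T : ℝ} (hT : T ≠ 0) (j : Fin L)
    (h0 : Integrable (P.gibbsDensity L T))
    (h2 : Integrable fun x => x.2 j ^ 2 * P.gibbsDensity L T x)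
    (h1 : Integrable fun x => x.2 j * P.gibbsDensity L T x) :
    ∫ x, (x.2 j ^ 2 - T) * P.gibbsDensity L T x = 0 := by
  have h := integral_mul_sq_sub_mul_gibbsDensity P hT j (F := fun _ => (1 : ℝ)) (F' := fun _ => 0)
    (fun x => hasLineDerivAt_zero_of_forall_add_smul j (fun _ _ => rfl) x)
    (by simpa using h0) (by simpa using h2) (by simpa using h1) (by simp)
  simpa using h

/-- **Invisibility.** If `F` does not depend on `p_j` (constant along the `p_j`-lines) then
`∫ F (p_j² − T) e^{-H/T} = 0` (`T ≠ 0`; `F e^{-H/T}`, `F p_j² e^{-H/T}`, `F p_j e^{-H/T}` integrable):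
the bath at site `j` does not see `F` to first order. [folklore] -/
theorem integral_mul_sq_sub_mul_gibbsDensity_eq_zero {T : ℝ} (hT : T ≠ 0) (j : Fin L)
    {F : PhaseSpace L → ℝ}
    (hF : ∀ (x : PhaseSpace L) (t : ℝ), F (x + t • ((0, Pi.single j 1) : PhaseSpace L)) = F x)
    (h0 : Integrable fun x => F x * P.gibbsDensity L T x)
    (h2 : Integrable fun x => F x * x.2 j ^ 2 * P.gibbsDensity L T x)
    (h1 : Integrable fun x => F x * x.2 j * P.gibbsDensity L T x) :
    ∫ x, F x * (x.2 j ^ 2 - T) * P.gibbsDensity L T x = 0 := by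
  have h := integral_mul_sq_sub_mul_gibbsDensity P hT j (F' := fun _ => 0)
    (fun x => hasLineDerivAt_zero_of_forall_add_smul j hF x) h0 h2 h1 (by simp)
  simpa using h

/-- **Gradient form for differentiable `F`**: `∫ F (p_j² − T) e^{-H/T} = T ∫ ∂_{p_j}F p_j e^{-H/T}`.
[folklore] -/
theorem integral_mul_sq_sub_mul_gibbsDensity_of_differentiable {T : ℝ} (hT : T ≠ 0) (j : Fin L)
    {F : PhaseSpace L → ℝ} (hF : Differentiable ℝ F)
    (h0 : Integrable fun x => F x * P.gibbsDensity L T x)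
    (h2 : Integrable fun x => F x * x.2 j ^ 2 * P.gibbsDensity L T x)
    (h1 : Integrable fun x => F x * x.2 j * P.gibbsDensity L T x)
    (h3 : Integrable fun x => partialP j F x * x.2 j * P.gibbsDensity L T x) :
    ∫ x, F x * (x.2 j ^ 2 - T) * P.gibbsDensity L T x =
      T * ∫ x, partialP j F x * x.2 j * P.gibbsDensity L T x :=
  integral_mul_sq_sub_mul_gibbsDensity P hT j (fun x => hasLineDerivAt_partialP hF j x) h0 h2 h1 h3

/-- Registered helper sub-goal `helper_bypassGaussianIBP` of stub `stub_bypassBound`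
(= `integral_mul_sq_sub_mul_gibbsDensity` in stub form): Gaussian integration by parts in a bath
momentum against the Gibbs density. [folklore] -/
theorem helper_bypassGaussianIBP : ∀ {L : ℕ} (P : OscillatorChain) {T : ℝ}, T ≠ 0 → ∀ (j : Fin L) {F F' : PhaseSpace L → ℝ}, (∀ x, HasLineDerivAt ℝ F (F' x) x ((0, Pi.single j 1) : PhaseSpace L)) → Integrable (fun x => F x * P.gibbsDensity L T x) → Integrable (fun x => F x * x.2 j ^ 2 * P.gibbsDensity L T x) → Integrable (fun x => F x * x.2 j * P.gibbsDensity L T x) → Integrable (fun x => F' x * x.2 j * P.gibbsDensity L T x) → ∫ x, F x * (x.2 j ^ 2 - T) * P.gibbsDensity L T x = T * ∫ x, F' x * x.2 j * P.gibbsDensity L T x :=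
  fun P _ hT j _ _ hF h0 h2 h1 h3 => integral_mul_sq_sub_mul_gibbsDensity P hT j hF h0 h2 h1 h3

end GaussianIBP

end Summit.AtomisticToContinuum.FouriersLaw.Cruxes.SuperadditiveResistance.FloatingProbeBypassLaplacian

end
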